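import Summits.AtomisticToContinuum.Crystallization.Theorems.ChargedEnergyGapFibreChargeB
import HarnessLib

/-!
# ChargedEnergyGap · NODE 83 «FibreCharge» (lens-3 g82) — file C of four: THE GLUE (LB) ⟸ (F) PROVED (finiteness of the marked holes, the line
fibres as an equivalence relation, existence and uniqueness of the key hole, the fibrewise regrouping, and one fibre read as a marked sequence)

Line of record `stmt-AtomisticToContinuum-14231` (`Summit.AtomisticToContinuum.ChargedEnergyGap`), route PricedLinkCensus; NODE 83 sits beneath NODE 82
«LineMoment» (tree `…Theorems.ChargedEnergyGapLineMomentA|B|∅`, cone of record `chargedEnergyGap_of_lineMoment_numerics`, 35 hypotheses).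

THIS FILE.  §C1: `fc_hKink_hAxis` (the attributed axis attains the max-kink), `fc_dist_line` (`dist = |t − t'| ρ` along a lattice line),
★ `fc_ball_lattice_finite` (lattice indices of an orthonormal frame within distance `R` of a point are finite: each coordinate is an inner product against
a unit vector), the line fibres `lineFiber` are reflexive / symmetric / transitive on marked holes (`fc_lineFiber_eq_of_mem`: a partition), ★ `fc_exists_key`
/ `fc_key_unique` (lexicographic maximum `(max-kink, −coordinate)` of a finite nonempty fibre), `lineKeyOf` and `fc_lineKeyOf_eq_iff` (the fibre of a key
is the set of marked holes whose key it is), ★★ `fc_fibre_bound` (the marked holes of the fibre of a key `k`, read through `t ↦ k + t e_a`, satisfy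
`IsMarkedFibre` with `kink1 = hMaxKink` — min-depth window from the `ρ`-Lipschitz bound, even offsets from the odd coordinate sums, span from the ball,
table clauses verbatim — so (F) bounds the fibre's table charge by `keyCharge k`), ★★★ `lineChargeQ_of_fibre : 0 < ρlo → FibreChargeQ R_N ρlo ρhi →
LineChargeQ R_N ρlo ρhi` (both `∑ᶠ` are finite sums over the marked holes; regroup by `lineKeyOf` with `Finset.sum_fiberwise_of_maps_to`; bound each fibre).

Imports ONLY `…ChargedEnergyGapFibreChargeB` and `HarnessLib`; no `set_option`, no `sorry`, no instance, no notation, no `private`.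
-/

noncomputable section

open scoped Classical
open Literature.MathematicalPhysics.StatisticalMechanics Literature.Geometry.DiscreteGeometry
open Summit.AtomisticToContinuum.Crystallization.Theses.PricedLinkCensus
open Summit.AtomisticToContinuum.Crystallization.Theorems.ChargedEnergyGapNegative

namespace Summit.AtomisticToContinuum.Crystallization.Theorems.ChargedEnergyGapChartDial

/-! ## §C1 THE GLUE (LB) ⟸ (F): finiteness, the line fibres, one key per fibre, and a fibre read as a marked sequence (PROVED) -/

section FibreGlue

variable {ρ : ℝ} {d : (Fin 3 → ℤ) → ℝ} {mk : (Fin 3 → ℤ) → Prop}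

/-- ★ The attributed axis attains the max-kink: `hKink w (hAxis w) = hMaxKink w`. -/
theorem fc_hKink_hAxis (ρ : ℝ) (d : (Fin 3 → ℤ) → ℝ) (w : Fin 3 → ℤ) : hKink ρ d w (hAxis ρ d w) = hMaxKink ρ d w := by
  unfold hAxis
  split_ifs with h0 h1
  · exact h0
  · exact h1
  · obtain ⟨i, -, hi⟩ := Finset.exists_mem_eq_sup' Finset.univ_nonempty (hKink ρ d w)
    have hm : hMaxKink ρ d w = hKink ρ d w i := hi
    fin_cases i
    · exact absurd hm.symm h0
    · exact absurd hm.symm h1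
    · exact hm.symm

/-- The two vertices of the hole `w` on axis `b`. [formal bookkeeping] -/
theorem fc_holeVertex_true (w : Fin 3 → ℤ) (b : Fin 3) : holeVertex w (b, true) = w + axisZ b := by
  simp [holeVertex, poleSign]

/-- [formal bookkeeping] -/
theorem fc_holeVertex_false (w : Fin 3 → ℤ) (b : Fin 3) : holeVertex w (b, false) = w - axisZ b := by
  simp [holeVertex, poleSign, sub_eq_add_neg]

/-- A lattice index on the axis-`a` line through `k` is `k + t e_a` with `t` its `a`-coordinate offset. [formal bookkeeping] -/
theorem fc_sameLine_iff (a : Fin 3) (k w : Fin 3 → ℤ) : SameLine a k w ↔ w = k + (w a - k a) • axisZ a := by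
  constructor
  · intro h
    funext i
    by_cases hi : i = a
    · subst hi; simp [axisZ]
    · simp [axisZ, hi, h i hi]
  · intro h i hi
    rw [h]
    simp [axisZ, hi]

/-- Lattice steps along a line. [formal bookkeeping] -/
theorem fc_line_succ (k : Fin 3 → ℤ) (t : ℤ) (a : Fin 3) : k + (t + 1) • axisZ a = (k + t • axisZ a) + axisZ a := by
  rw [add_smul, one_smul, add_assoc]

/-- [formal bookkeeping] -/
theorem fc_line_pred (k : Fin 3 → ℤ) (t : ℤ) (a : Fin 3) : k + (t - 1) • axisZ a = (k + t • axisZ a) - axisZ a := by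
  rw [sub_smul, one_smul, add_sub_assoc]

/-- Distances along a lattice line of an orthonormal cubic frame: `dist(k + t e_a, k + t' e_a) = |t − t'| ρ`. [formal bookkeeping] -/
theorem fc_dist_line {c₀ : E3} {f : Fin 3 → E3} (hf : Orthonormal ℝ f) {ρ : ℝ} (hρ : 0 ≤ ρ) (k : Fin 3 → ℤ) (a : Fin 3) (t t' : ℤ) :
    dist (cubicPt c₀ f ρ (k + t • axisZ a)) (cubicPt c₀ f ρ (k + t' • axisZ a)) = |((t : ℝ) - t')| * ρ := by
  rw [lm_cubicPt_add_zsmul, lm_cubicPt_add_zsmul, dist_eq_norm]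
  have : cubicPt c₀ f ρ k + ((t : ℝ) * ρ) • f a - (cubicPt c₀ f ρ k + ((t' : ℝ) * ρ) • f a) = (((t : ℝ) - t') * ρ) • f a := by
    rw [sub_mul, sub_smul]; abel
  rw [this, norm_smul, hf.1 a, mul_one, Real.norm_eq_abs, abs_mul, abs_of_nonneg hρ]

/-- ★ FINITENESS: the lattice indices of an orthonormal cubic frame (`ρ > 0`) within distance `R` of a point form a finite set (each coordinate is
bounded by `(R + dist(x, c₀))/ρ`: the coefficient of `f_i` is an inner product against a unit vector). -/
theorem fc_ball_lattice_finite {c₀ : E3} {f : Fin 3 → E3} (hf : Orthonormal ℝ f) {ρ : ℝ} (hρ : 0 < ρ) (x : E3) (R : ℝ) :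
    {w : Fin 3 → ℤ | dist x (cubicPt c₀ f ρ w) ≤ R}.Finite := by
  obtain ⟨N, hN⟩ : ∃ N : ℤ, (R + dist x c₀) / ρ ≤ N := ⟨⌈(R + dist x c₀) / ρ⌉, Int.le_ceil _⟩
  refine (Set.Finite.pi (fun _ : Fin 3 => Set.finite_Icc (-N) N)).subset (fun w hw => ?_)
  rw [Set.mem_setOf_eq, dist_comm] at hw
  rw [Set.mem_univ_pi]
  intro i
  have hv : cubicPt c₀ f ρ w - c₀ = ∑ j, ((w j : ℝ) * ρ) • f j := by
    unfold cubicPt; exact add_sub_cancel_left _ _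
  have h1 := hf.inner_right_fintype (fun j => (w j : ℝ) * ρ) i
  have h2 := abs_real_inner_le_norm (f i) (∑ j, ((w j : ℝ) * ρ) • f j)
  rw [h1, hf.1 i, one_mul, ← hv, ← dist_eq_norm, abs_mul, abs_of_pos hρ] at h2
  have h3 := dist_triangle (cubicPt c₀ f ρ w) x c₀
  have h4 : |(w i : ℝ)| ≤ N := by
    refine le_trans ?_ hN
    rw [le_div_iff₀ hρ]
    linarith
  obtain ⟨h5, h6⟩ := abs_le.1 h4
  exact ⟨by exact_mod_cast h5, by exact_mod_cast h6⟩

/-- A marked hole lies in its own line fibre. [formal bookkeeping] -/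
theorem fc_mem_lineFiber_self {w : Fin 3 → ℤ} (hw : mk w) : w ∈ lineFiber ρ d mk w :=
  ⟨hw, rfl, fun _ _ => rfl⟩

/-- Line fibres are symmetric … [formal bookkeeping] -/
theorem fc_lineFiber_symm {w w' : Fin 3 → ℤ} (hw : mk w) (h : w' ∈ lineFiber ρ d mk w) : w ∈ lineFiber ρ d mk w' := by
  obtain ⟨_, hax, hsl⟩ := h
  refine ⟨hw, hax.symm, fun i hi => ?_⟩
  rw [hax] at hi
  exact (hsl i hi).symm

/-- … and transitive. [formal bookkeeping] -/
theorem fc_lineFiber_trans {w₁ w₂ w₃ : Fin 3 → ℤ} (h12 : w₂ ∈ lineFiber ρ d mk w₁) (h23 : w₃ ∈ lineFiber ρ d mk w₂) :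
    w₃ ∈ lineFiber ρ d mk w₁ := by
  obtain ⟨_, hax2, hsl2⟩ := h12
  obtain ⟨hm3, hax3, hsl3⟩ := h23
  refine ⟨hm3, hax3.trans hax2, fun i hi => ?_⟩
  rw [hsl2 i hi]
  exact hsl3 i (by rwa [hax2])

/-- ★ The line fibre of any member of a fibre is that fibre (fibres partition the marked holes). -/
theorem fc_lineFiber_eq_of_mem {w w' : Fin 3 → ℤ} (hw : mk w) (h : w' ∈ lineFiber ρ d mk w) :
    lineFiber ρ d mk w' = lineFiber ρ d mk w := by
  ext u
  exact ⟨fun hu => fc_lineFiber_trans h hu, fun hu => fc_lineFiber_trans (fc_lineFiber_symm hw h) hu⟩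

/-- Line fibres consist of marked holes. [formal bookkeeping] -/
theorem fc_lineFiber_subset (w : Fin 3 → ℤ) : lineFiber ρ d mk w ⊆ {u | mk u} := fun _ hu => hu.1

/-- ★ EXISTENCE OF THE KEY: if the marked holes form a finite set, the fibre of every marked hole has a key hole (the lexicographic maximum
`(max-kink, −coordinate)` of a finite nonempty set). -/
theorem fc_exists_key (hfin : {u | mk u}.Finite) {w : Fin 3 → ℤ} (hw : mk w) :
    ∃ k, IsKey ρ d mk k ∧ k ∈ lineFiber ρ d mk w := by
  obtain ⟨F, hF⟩ : ∃ F : Finset (Fin 3 → ℤ), ∀ u, u ∈ F ↔ u ∈ lineFiber ρ d mk w :=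
    ⟨(hfin.subset (fc_lineFiber_subset (ρ := ρ) (d := d) w)).toFinset, fun u => Set.Finite.mem_toFinset _⟩
  have hne : F.Nonempty := ⟨w, (hF w).2 (fc_mem_lineFiber_self hw)⟩
  obtain ⟨u₁, hu₁, hmax⟩ := Finset.exists_max_image F (hMaxKink ρ d) hne
  obtain ⟨F₁, hF₁⟩ : ∃ F₁ : Finset (Fin 3 → ℤ), ∀ u, u ∈ F₁ ↔ u ∈ F ∧ hMaxKink ρ d u = hMaxKink ρ d u₁ :=
    ⟨F.filter (fun u => hMaxKink ρ d u = hMaxKink ρ d u₁), fun u => Finset.mem_filter⟩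
  have hne₁ : F₁.Nonempty := ⟨u₁, (hF₁ u₁).2 ⟨hu₁, rfl⟩⟩
  obtain ⟨k, hk, hmin⟩ := Finset.exists_min_image F₁ (fun u => u (hAxis ρ d w)) hne₁
  obtain ⟨hkF, hkK⟩ := (hF₁ k).1 hk
  have hkw : k ∈ lineFiber ρ d mk w := (hF k).1 hkF
  refine ⟨k, ⟨hkw.1, fun u hu => ?_⟩, hkw⟩
  have hax : hAxis ρ d k = hAxis ρ d w := hkw.2.1
  rw [fc_lineFiber_eq_of_mem hw hkw] at hu
  have huF : u ∈ F := (hF u).2 hu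
  rcases (hmax u huF).lt_or_eq with hlt | heq
  · left; rwa [hkK]
  · right
    refine ⟨by rw [heq, hkK], ?_⟩
    rw [hax]
    exact hmin u ((hF₁ u).2 ⟨huF, heq⟩)

/-- ★ UNIQUENESS OF THE KEY: two key holes in one fibre coincide (equal max-kinks, equal coordinates along the common axis, same line). -/
theorem fc_key_unique {k k' : Fin 3 → ℤ} (hk : IsKey ρ d mk k) (hk' : IsKey ρ d mk k') (h : k' ∈ lineFiber ρ d mk k) : k = k' := by
  have h' : k ∈ lineFiber ρ d mk k' := fc_lineFiber_symm hk.1 h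
  have hax : hAxis ρ d k' = hAxis ρ d k := h.2.1
  rcases hk.2 k' h with hlt | ⟨heq, hle⟩
  · rcases hk'.2 k h' with hlt' | ⟨heq', -⟩
    · exact absurd (hlt.trans hlt') (lt_irrefl _)
    · exact absurd heq' hlt.ne'
  · rcases hk'.2 k h' with hlt' | ⟨-, hle'⟩
    · exact absurd heq hlt'.ne'
    · rw [hax] at hle'
      funext i
      by_cases hi : i = hAxis ρ d k
      · rw [hi]; exact le_antisymm hle hle'
      · exact h.2.2 i hi

/-- ★ The KEY OF the fibre of `w` (by choice; meaningful for marked `w` of a finite marking). -/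
def lineKeyOf (ρ : ℝ) (d : (Fin 3 → ℤ) → ℝ) (mk : (Fin 3 → ℤ) → Prop) (w : Fin 3 → ℤ) : Fin 3 → ℤ :=
  if h : ∃ k, IsKey ρ d mk k ∧ k ∈ lineFiber ρ d mk w then h.choose else w

/-- [formal bookkeeping] -/
theorem fc_lineKeyOf_spec (hfin : {u | mk u}.Finite) {w : Fin 3 → ℤ} (hw : mk w) :
    IsKey ρ d mk (lineKeyOf ρ d mk w) ∧ lineKeyOf ρ d mk w ∈ lineFiber ρ d mk w := by
  have h := fc_exists_key (ρ := ρ) (d := d) hfin hw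
  unfold lineKeyOf
  rw [dif_pos h]
  exact h.choose_spec

/-- ★ The fibre of a key `k` is exactly the set of marked holes whose key is `k`. -/
theorem fc_lineKeyOf_eq_iff (hfin : {u | mk u}.Finite) {w : Fin 3 → ℤ} (hw : mk w) {k : Fin 3 → ℤ} (hk : IsKey ρ d mk k) :
    lineKeyOf ρ d mk w = k ↔ w ∈ lineFiber ρ d mk k := by
  obtain ⟨hK, hmem⟩ := fc_lineKeyOf_spec (ρ := ρ) (d := d) hfin hw
  constructor
  · rintro rfl; exact fc_lineFiber_symm hw hmem
  · intro h; exact (fc_key_unique hk hK (fc_lineFiber_trans h hmem)).symm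

/-- ★★ **ONE FIBRE READ AS A MARKED SEQUENCE**: under the hypotheses of (LB), the marked holes of the line fibre of a key `k` (axis `a = hAxis k`),
read through `t ↦ k + t e_a`, form a marked fibre `(e, m, S, 0)` in the sense of `IsMarkedFibre` with `e(t) = d(k + t e_a)`, `m(t) =` the hole
min-depth, `kink1 = hMaxKink` (every hole of the fibre is attributed to `a`); hence (F) bounds the fibre's table charge by the key charge of `k`. -/
theorem fc_fibre_bound {R_N ρlo ρhi ρ : ℝ} (hFQ : FibreChargeQ R_N ρlo ρhi) (hρ₁ : ρlo ≤ ρ) (hρ₂ : ρ ≤ ρhi) (hρ : 0 < ρ)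
    {c₀ : E3} {f : Fin 3 → E3} (hf : Orthonormal ℝ f)
    (hd0 : ∀ w, 0 ≤ d w) (hd1 : ∀ w a, |d (w + axisZ a) - d w| ≤ ρ)
    (hd2 : ∀ w a, d (w + axisZ a) ^ 2 + d (w - axisZ a) ^ 2 ≤ 2 * d w ^ 2 + 2 * ρ ^ 2)
    {x : E3}
    (hmk : ∀ w, mk w → Odd (∑ i, w i) ∧ dist x (cubicPt c₀ f ρ w) ≤ R_N + ρ ∧ 1 ≤ capKRow (hDepthMin d w) ∧
      2 ≤ capKCol (hMaxKink ρ d w) ∧ hDepthMin d w < 140)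
    {F : Finset (Fin 3 → ℤ)} {k : Fin 3 → ℤ} (hk : IsKey ρ d mk k) (hmemF : ∀ w, w ∈ F ↔ w ∈ lineFiber ρ d mk k) :
    ∑ w ∈ F, capK (hDepthMin d w) (hMaxKink ρ d w) ≤
      capK (hDepthMin d k) (hMaxKink ρ d k) + lineExcess (capKCol (hMaxKink ρ d k)) F.card := by
  obtain ⟨a, ha⟩ : ∃ a, hAxis ρ d k = a := ⟨_, rfl⟩
  obtain ⟨φ, hφ⟩ : ∃ φ : ℤ → (Fin 3 → ℤ), ∀ t, φ t = k + t • axisZ a := ⟨_, fun _ => rfl⟩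
  obtain ⟨e, he⟩ : ∃ e : ℤ → ℝ, ∀ t, e t = d (φ t) := ⟨_, fun _ => rfl⟩
  obtain ⟨m, hm⟩ : ∃ m : ℤ → ℝ, ∀ t, m t = hDepthMin d (φ t) := ⟨_, fun _ => rfl⟩
  obtain ⟨ψ, hψ⟩ : ∃ ψ : (Fin 3 → ℤ) → ℤ, ∀ w, ψ w = w a - k a := ⟨_, fun _ => rfl⟩
  have hφψ : ∀ w ∈ F, φ (ψ w) = w := by
    intro w hw
    rw [hφ, hψ]
    exact ((fc_sameLine_iff a k w).1 (ha ▸ ((hmemF w).1 hw).2.2)).symm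
  have hψinj : Set.InjOn ψ ↑F := by
    intro w hw w' hw' h
    rw [← hφψ w hw, ← hφψ w' hw', h]
  have hφs : ∀ t, φ (t + 1) = φ t + axisZ a := by intro t; rw [hφ, hφ, fc_line_succ]
  have hφp : ∀ t, φ (t - 1) = φ t - axisZ a := by intro t; rw [hφ, hφ, fc_line_pred]
  have hφ0 : φ 0 = k := by rw [hφ, zero_smul, add_zero]
  have hkink : ∀ t, kink1 ρ e t = hKink ρ d (φ t) a := by
    intro t; simp only [kink1, hKink, he, hφs, hφp]
  have haxF : ∀ w ∈ F, hAxis ρ d w = a := fun w hw => ((hmemF w).1 hw).2.1.trans ha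
  have hkinkF : ∀ w ∈ F, kink1 ρ e (ψ w) = hMaxKink ρ d w := by
    intro w hw; rw [hkink, hφψ w hw, ← haxF w hw, fc_hKink_hAxis]
  have hmF : ∀ w ∈ F, m (ψ w) = hDepthMin d w := by intro w hw; rw [hm, hφψ w hw]
  have hkF : k ∈ F := (hmemF k).2 (fc_mem_lineFiber_self hk.1)
  have hψk : ψ k = 0 := by rw [hψ, sub_self]
  -- the marked fibre
  have hMF : IsMarkedFibre R_N ρ e m (F.image ψ) 0 := by
    refine ⟨fun t => by rw [he]; exact hd0 _, fun t => ?_, fun t => ?_, fun t => ⟨?_, ?_, ?_⟩, ?_, ?_, ?_, ?_⟩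
    · rw [he, he, hφs]; exact hd1 _ _
    · rw [he, he, he, hφs, hφp]; exact hd2 _ _
    · rw [he, hm, hDepthMin]
      refine Finset.le_inf' _ _ (fun u _ => ?_)
      obtain ⟨b, _ | _⟩ := u
      · rw [fc_holeVertex_false]
        have h1 := hd1 (φ t - axisZ b) b
        rw [sub_add_cancel] at h1
        linarith [(abs_le.1 h1).2]
      · rw [fc_holeVertex_true]
        linarith [(abs_le.1 (hd1 (φ t) b)).1]
    · rw [hm, he, hφp, hDepthMin, ← fc_holeVertex_false]
      exact Finset.inf'_le _ (Finset.mem_univ _)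
    · rw [hm, he, hφs, hDepthMin, ← fc_holeVertex_true]
      exact Finset.inf'_le _ (Finset.mem_univ _)
    · intro t ht t' ht'
      obtain ⟨w, hw, rfl⟩ := Finset.mem_image.1 ht
      obtain ⟨w', hw', rfl⟩ := Finset.mem_image.1 ht'
      obtain ⟨hodd, hdist, -⟩ := hmk w ((hmemF w).1 hw).1
      obtain ⟨hodd', hdist', -⟩ := hmk w' ((hmemF w').1 hw').1
      refine ⟨?_, ?_⟩
      · have h1 : ∑ i, w i = (∑ i, k i) + ψ w := by
          conv_lhs => rw [← hφψ w hw, hφ]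
          exact cf_sum_add_zsmul_axisZ k (ψ w) a
        have h2 : ∑ i, w' i = (∑ i, k i) + ψ w' := by
          conv_lhs => rw [← hφψ w' hw', hφ]
          exact cf_sum_add_zsmul_axisZ k (ψ w') a
        have h3 : ψ w - ψ w' = ∑ i, w i - ∑ i, w' i := by rw [h1, h2]; ring
        rw [h3]
        exact Odd.sub_odd hodd hodd'
      · have h1 := fc_dist_line (c₀ := c₀) hf hρ.le k a (ψ w) (ψ w')
        rw [← hφ, ← hφ, hφψ w hw, hφψ w' hw'] at h1
        rw [← h1]
        have h2 := dist_triangle (cubicPt c₀ f ρ w) x (cubicPt c₀ f ρ w')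
        rw [dist_comm] at hdist
        linarith
    · intro t ht
      obtain ⟨w, hw, rfl⟩ := Finset.mem_image.1 ht
      obtain ⟨-, -, hr, hc, hu⟩ := hmk w ((hmemF w).1 hw).1
      rw [hmF w hw, hkinkF w hw]
      exact ⟨hr, hc, hu⟩
    · exact Finset.mem_image.2 ⟨k, hkF, hψk⟩
    · intro t ht
      obtain ⟨w, hw, rfl⟩ := Finset.mem_image.1 ht
      rw [hkinkF w hw, ← hψk, hkinkF k hkF, hψk, hψ, sub_nonneg]
      rcases hk.2 w ((hmemF w).1 hw) with hlt | ⟨heq, hle⟩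
      · exact Or.inl hlt
      · exact Or.inr ⟨heq, by rw [ha] at hle; exact hle⟩
  -- apply (F) and translate back
  have hineq := hFQ ρ hρ₁ hρ₂ e m (F.image ψ) 0 hMF
  rw [Finset.card_image_of_injOn hψinj, Finset.sum_image hψinj, ← hψk, hmF k hkF, hkinkF k hkF] at hineq
  calc ∑ w ∈ F, capK (hDepthMin d w) (hMaxKink ρ d w) = ∑ w ∈ F, capK (m (ψ w)) (kink1 ρ e (ψ w)) :=
        Finset.sum_congr rfl (fun w hw => by rw [hmF w hw, hkinkF w hw])
    _ ≤ _ := hineq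

/-- ★★★ **THE GLUE (LB) ⟸ (F)** (`0 < ρlo`): the marked holes form a finite set (ball ∩ lattice); they are partitioned by the line fibres (same
attributed axis, same axis line — an equivalence relation), each fibre has exactly one key hole (`fc_exists_key`, `fc_key_unique`); regrouping the
marked sum by keys (`Finset.sum_fiberwise_of_maps_to` along `lineKeyOf`) and bounding each fibre by `fc_fibre_bound` gives `Σ capK ≤ Σ keyCharge`. -/
theorem lineChargeQ_of_fibre {R_N ρlo ρhi : ℝ} (hlo : 0 < ρlo) (hFQ : FibreChargeQ R_N ρlo ρhi) : LineChargeQ R_N ρlo ρhi := by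
  intro ρ hρ₁ hρ₂ c₀ f hf d hd0 hd1 hd2 x mk hmk
  have hρ : 0 < ρ := lt_of_lt_of_le hlo hρ₁
  have hfin : {w | mk w}.Finite :=
    (fc_ball_lattice_finite (c₀ := c₀) hf hρ x (R_N + ρ)).subset (fun w hw => (hmk w hw).2.1)
  obtain ⟨M, hM⟩ : ∃ M : Finset (Fin 3 → ℤ), ∀ w, w ∈ M ↔ mk w := ⟨hfin.toFinset, fun w => Set.Finite.mem_toFinset _⟩
  -- both sides as finite sums over the marked holes
  have hL : ∑ᶠ w, (if mk w then capK (hDepthMin d w) (hMaxKink ρ d w) else 0) = ∑ w ∈ M, capK (hDepthMin d w) (hMaxKink ρ d w) := by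
    rw [finsum_eq_sum_of_support_subset _ (s := M) ?_]
    · exact Finset.sum_congr rfl (fun w hw => if_pos ((hM w).1 hw))
    · intro w hw
      rw [Function.mem_support] at hw
      rw [Finset.mem_coe, hM]
      by_contra h
      exact hw (if_neg h)
  have hR : ∑ᶠ w, keyCharge ρ d mk w =
      ∑ w ∈ M.filter (fun w => IsKey ρ d mk w),
        (capK (hDepthMin d w) (hMaxKink ρ d w) + lineExcess (capKCol (hMaxKink ρ d w)) (lineCount ρ d mk w)) := by
    rw [finsum_eq_sum_of_support_subset _ (s := M) ?_]
    · rw [Finset.sum_filter]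
      exact Finset.sum_congr rfl (fun w _ => by unfold keyCharge; rfl)
    · intro w hw
      rw [Function.mem_support] at hw
      rw [Finset.mem_coe, hM]
      by_contra h
      apply hw
      unfold keyCharge
      rw [if_neg (fun hk => h hk.1)]
  rw [hL, hR]
  -- regroup the marked sum by keys
  have hmaps : ∀ w ∈ M, lineKeyOf ρ d mk w ∈ M.filter (fun w => IsKey ρ d mk w) := by
    intro w hw
    obtain ⟨hK, -⟩ := fc_lineKeyOf_spec (ρ := ρ) (d := d) hfin ((hM w).1 hw)
    exact Finset.mem_filter.2 ⟨(hM _).2 hK.1, hK⟩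
  rw [← Finset.sum_fiberwise_of_maps_to hmaps]
  refine Finset.sum_le_sum (fun k hk => ?_)
  obtain ⟨-, hkK⟩ := Finset.mem_filter.1 hk
  have hmemF : ∀ w, w ∈ M.filter (fun w => lineKeyOf ρ d mk w = k) ↔ w ∈ lineFiber ρ d mk k := by
    intro w
    rw [Finset.mem_filter, hM]
    constructor
    · rintro ⟨hw, hkw⟩; exact (fc_lineKeyOf_eq_iff hfin hw hkK).1 hkw
    · intro h; exact ⟨h.1, (fc_lineKeyOf_eq_iff hfin h.1 hkK).2 h⟩
  have hcount : lineCount ρ d mk k = (M.filter (fun w => lineKeyOf ρ d mk w = k)).card := by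
    unfold lineCount
    have hset : lineFiber ρ d mk k = ↑(M.filter (fun w => lineKeyOf ρ d mk w = k)) := by
      ext w; rw [Finset.mem_coe, hmemF]
    rw [hset, Set.ncard_coe_finset]
  rw [hcount]
  exact fc_fibre_bound hFQ hρ₁ hρ₂ hρ hf hd0 hd1 hd2 hmk hkK hmemF

end FibreGlue

end Summit.AtomisticToContinuum.Crystallization.Theorems.ChargedEnergyGapChartDial
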